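import Summits.BirchSwinnertonDyer.BirchSwinnertonDyer.Theorems.PrintCFramBottomClassIndexLawFiveLeSelmerCountEvenRegularFree
import Summits.BirchSwinnertonDyer.BirchSwinnertonDyer.Theorems.RamifiedSevenEllipticUnitsFrameDataOfGZK
import HarnessLib

/-!
# Route `PrintCFram`, crux C2 `BottomClassIndexLawFiveLe` (stmt-BirchSwinnertonDyer-20372), line
# `eisenstein-resource-bdp-line` (registry v22, stubs B1-level `stub_bsdp_of_level` / B1-sha `stub_bsdp_of_sha`):
# **B1-sha REDUCES TO ITS LEVEL-0 PART, and the level-0 part lives on EVEN-IRREGULAR members** (registry-currency bookkeeping for the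
# promotion dossier) (cell `bsd-print-cfram`, width seat `bsd-line-cfram-p1-w2` g11; helper `--supports` 20372; 0 defs, 0 facts, 0 sorry;
# CONDITIONAL only on the named facts it lists: GZK for §1; Cassels–Tate + GZK for §2)

HONEST FRAMING. Nothing about BSD is proved here and no stub is closed; B1-level and B1-sha stay OPEN (LEAD g12: promote). Two logical
reshufflings of registry v22's arithmetic pair for the planner, using only landed theorems:

* §1 **`stubB1Sha_of_stubB1Level_of_levelZero`** — `stub_bsdp_of_sha` (verbatim) ⟸ `stub_bsdp_of_level` (verbatim) ∧ **B1-sha⁰** := «`BSD_p`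
  for the rank-one class members with `Ш(W)[p] ≠ 0` whose generator has LEVEL `0` (`p • Q ≠ P` in `W(ℚ_p)`)», granted GZK: every rank-one
  member has a generator with an exact level `n` (`RamifiedSevenEllipticUnits.exists_generator_with_level`); `n ≥ 1` is B1-level's premise,
  `n = 0` is B1-sha⁰'s. (Conversely B1-sha ⟹ B1-sha⁰ trivially: `stubB1ShaLevelZero_of_stubB1Sha`.) So the pair (B1-level, B1-sha) may be
  filed as (B1-level, B1-sha⁰) with no loss.
* §2 **`not_evenRegular_of_sha_ne_zero`** — on a rank-one class member with a Kriz–Li odd datum `(f, ψ, ω)`, `Ш(W)[p] ≠ 0` ⟹ NOT every abelian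
  realisation of the even character `ωψ⁻¹` is class-group regular (contrapositive of w4 g10's `sha_noPTorsion_of_evenRegularClassGroup`,
  p683684; mod Cassels–Tate + GZK). With this seat's `…SelmerCountLevelZeroIrregular` (LEVEL `0` ∧ EVEN-IRREGULAR at the reflection field ⟹
  `Ш(W)[p] ≠ 0`, mod Milne I 2.8) the members of B1-sha⁰ are exactly the LEVEL-`0` EVEN-IRREGULAR members (up to the currency of the
  irregular realisation: ANY abelian `K` here, the CM reflection field `K' ∋ ζ_p` there).

THEOREMS ONLY; no definition, no named fact, no `sorry`. BSD is not proved by any of this; no summit statement is proved by this seat.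
References: [SilvermanAEC2009] X.§4; [Washington1997] §10.2; [BurungaleKobayashiNakamuraOta2026] §1.4 (why B1 is open); seat notes w2g11 §1.
-/

set_option autoImplicit false
-- `…BirchSwinnertonDyer.BirchSwinnertonDyer.Theorems…` is the problem's mandated namespace (D-0017).
set_option linter.dupNamespace false

noncomputable section

open scoped Classical

namespace Summit.BirchSwinnertonDyer.BirchSwinnertonDyer.Theorems.PrintCFram.SelmerCount

open NumberField IsDedekindDomain Field WeierstrassCurve DirichletCharacter
open Literature.NumberTheory.NumberFields Literature.NumberTheory.EllipticCurves Literature.NumberTheory.GaloisRepresentations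
  Literature.NumberTheory.EllipticCurves.Rank1Residual Literature.NumberTheory.EllipticCurves.KrizLi2019

/-! ## §1 B1-sha ⟸ B1-level ∧ B1-sha⁰ (and B1-sha ⟹ B1-sha⁰) -/

/-- **`stub_bsdp_of_sha` ⟸ `stub_bsdp_of_level` ∧ B1-sha⁰ (granted GZK).** If `BSD_p` holds for every rank-one CM-ramified member whose
generator is `p`-divisible in `W(ℚ_p)` (registry v22 `stub_bsdp_of_level`, verbatim) and for every rank-one member with `Ш(W)[p] ≠ 0` whose
generator has LEVEL `0`, then it holds for every rank-one member with `Ш(W)[p] ≠ 0` (`stub_bsdp_of_sha`, verbatim): a generator with an exact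
level exists (`exists_generator_with_level`, GZK for `rank = 1`), and its level is `0` or `≥ 1`. [cite: SilvermanAEC2009, X.§4]
[cite: BurungaleKobayashiNakamuraOta2026, §1.4] -/
theorem stubB1Sha_of_stubB1Level_of_levelZero (hGZK : rank_eq_analyticRank_of_analyticRank_le_one)
    (hLevel : ∀ (W : WeierstrassCurve ℚ) [W.IsElliptic] [W.IsGloballyMinimal] (p : ℕ) [Fact p.Prime],
      W.HasCM → CMRamified W p → 5 ≤ p → W.analyticRank = 1 →
      ∀ P : W.toAffine.Point, ¬ IsOfFinAddOrder P →
        (∀ R : W.toAffine.Point, ∃ (k : ℤ) (T : W.toAffine.Point), IsOfFinAddOrder T ∧ R = k • P + T) →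
        (∃ Q : (W.baseChange ℚ_[p]).toAffine.Point, p • Q = W.toPadicPoint p P) →
        BSDp W p)
    (hShaZero : ∀ (W : WeierstrassCurve ℚ) [W.IsElliptic] [W.IsGloballyMinimal] (p : ℕ) [Fact p.Prime],
      W.HasCM → CMRamified W p → 5 ≤ p → W.analyticRank = 1 →
      ∀ P : W.toAffine.Point, ¬ IsOfFinAddOrder P →
        (∀ R : W.toAffine.Point, ∃ (k : ℤ) (T : W.toAffine.Point), IsOfFinAddOrder T ∧ R = k • P + T) →
        (∀ Q : (W.baseChange ℚ_[p]).toAffine.Point, p • Q ≠ W.toPadicPoint p P) →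
        (∃ s ∈ W.sha, s ≠ 0 ∧ p • s = 0) → BSDp W p) :
    ∀ (W : WeierstrassCurve ℚ) [W.IsElliptic] [W.IsGloballyMinimal] (p : ℕ) [Fact p.Prime],
      W.HasCM → CMRamified W p → 5 ≤ p → W.analyticRank = 1 →
      (∃ s ∈ W.sha, s ≠ 0 ∧ p • s = 0) → BSDp W p := by
  intro W _ _ p _ hCM hram h5 hr hsha
  have hrank : W.mordellWeilRank = 1 := by rw [(hGZK W hr.le).1, hr]
  obtain ⟨P, n, hPtor, hgen, ⟨Q, hQ⟩, hnot⟩ := RamifiedSevenEllipticUnits.exists_generator_with_level W p hrank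
  rcases Nat.eq_zero_or_pos n with rfl | hn
  · -- level `0`
    exact hShaZero W p hCM hram h5 hr P hPtor hgen (fun Q' hQ' ↦ hnot Q' (by rw [zero_add, pow_one]; exact hQ')) hsha
  · -- level `n ≥ 1`: `p • (p^(n-1) • Q) = P`
    refine hLevel W p hCM hram h5 hr P hPtor hgen ⟨p ^ (n - 1) • Q, ?_⟩
    rw [← mul_nsmul', ← pow_succ', Nat.sub_add_cancel hn, hQ]

/-- **B1-sha ⟹ B1-sha⁰** (the level-0 part is a sub-statement). [cite: SilvermanAEC2009, X.§4] -/
theorem stubB1ShaLevelZero_of_stubB1Sha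
    (hSha : ∀ (W : WeierstrassCurve ℚ) [W.IsElliptic] [W.IsGloballyMinimal] (p : ℕ) [Fact p.Prime],
      W.HasCM → CMRamified W p → 5 ≤ p → W.analyticRank = 1 →
      (∃ s ∈ W.sha, s ≠ 0 ∧ p • s = 0) → BSDp W p) :
    ∀ (W : WeierstrassCurve ℚ) [W.IsElliptic] [W.IsGloballyMinimal] (p : ℕ) [Fact p.Prime],
      W.HasCM → CMRamified W p → 5 ≤ p → W.analyticRank = 1 →
      ∀ P : W.toAffine.Point, ¬ IsOfFinAddOrder P →
        (∀ R : W.toAffine.Point, ∃ (k : ℤ) (T : W.toAffine.Point), IsOfFinAddOrder T ∧ R = k • P + T) →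
        (∀ Q : (W.baseChange ℚ_[p]).toAffine.Point, p • Q ≠ W.toPadicPoint p P) →
        (∃ s ∈ W.sha, s ≠ 0 ∧ p • s = 0) → BSDp W p :=
  fun W _ _ p _ hCM hram h5 hr _ _ _ _ hsha ↦ hSha W p hCM hram h5 hr hsha

/-! ## §2 `Ш(W)[p] ≠ 0` forces EVEN-IRREGULARITY (contrapositive of w4 g10's small-Selmer theorem) -/

variable (W : WeierstrassCurve ℚ) [W.IsElliptic] [W.IsGloballyMinimal]
variable {p : ℕ} [hp : Fact p.Prime]

/-- **`Ш(W)[p] ≠ 0` ⟹ some abelian realisation of `θ_e = ωψ⁻¹` is class-group IRREGULAR** (mod Cassels–Tate, GZK). `W/ℚ` globally minimal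
with CM, `p ≥ 5` CM-ramified, `r_an(W) = 1`, `(f, ψ, ω)` a Kriz–Li odd datum with the trace form `hss`, `v ∋ p`. If `Ш(W/ℚ)` has a non-zero
element killed by `p`, then NOT every number field `K` abelian over `ℚ` with `p ∤ [K:ℚ]` and every `χ : Gal(K/ℚ) →* ℤ_pˣ` realising `ω ψ⁻¹`
has `#e_χ(ℤ_p ⊗ Cl K) = 1` — i.e. there is an irregular realisation. Contrapositive of w4 g10's `sha_noPTorsion_of_evenRegularClassGroup`
(p683684). So B1-sha's premise implies EVEN-IRREGULARITY; with `…SelmerCountLevelZeroIrregular` §3 the converse holds at LEVEL `0`.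
[cite: Washington1997, §10.2 (Thm. 10.9)] [cite: Cassels1962ArithmeticIV] -/
theorem exists_evenIrregular_realisation_of_sha_ne_zero
    (hCT : exists_casselsTate_pairing (K := ℚ)) (hGZK : rank_eq_analyticRank_of_analyticRank_le_one)
    (hCM : W.HasCM) (hram : CMRamified W p) (h5 : 5 ≤ p) (hr : W.analyticRank = 1)
    {f : ℕ} [NeZero f] (ψ : DirichletCharacter ℚ_[p] f) (ω : DirichletCharacter ℚ_[p] p)
    (hψ : ψ.Odd) (hω : IsTeichmullerCharacter ω)
    (hss : ∀ ℓ : ℕ, ℓ.Prime → ¬ (ℓ ∣ p * W.conductorNorm ℤ) →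
      ‖((W.LFunction ℓ : ℤ) : ℚ_[p]) - (ψ (ℓ : ZMod f) + ψ⁻¹ (ℓ : ZMod f) * ω (ℓ : ZMod p))‖ < 1)
    {v : HeightOneSpectrum (𝓞 ℚ)} (hpv : ((p : ℕ) : 𝓞 ℚ) ∈ v.asIdeal)
    (hsha : ∃ s ∈ W.sha, s ≠ 0 ∧ p • s = 0) :
    ∃ (K : Type) (_ : Field K) (_ : NumberField K) (_ : IsAbelianGalois ℚ K) (χ : (K ≃ₐ[ℚ] K) →* ℤ_[p]ˣ),
      ¬ p ∣ Module.finrank ℚ K ∧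
      (∀ τ : absoluteGaloisGroup ℚ, (((χ (absGaloisQuot ℚ K τ) : ℤ_[p]ˣ) : ℤ_[p]) : ℚ_[p]) =
        ω ((modNCyclotomicCharacter ℚ p τ : (ZMod p)ˣ) : ZMod p) *
          (ψ ((modNCyclotomicCharacter ℚ f τ : (ZMod f)ˣ) : ZMod f))⁻¹) ∧
      classGroupChiCard ℚ K p (fun g => ((χ g : ℤ_[p]ˣ) : ℤ_[p])) ≠ 1 := by
  by_contra hreg
  push Not at hreg
  obtain ⟨s, hs, hs0, hps⟩ := hsha
  have h0 := sha_noPTorsion_of_evenRegularClassGroup W hCT hGZK hCM hram h5 hr ψ ω hψ hω hss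
    (fun K _ _ iK hpK χ hχ ↦ hreg K _ _ iK χ hpK hχ) hpv ⟨s, hs⟩ (Subtype.ext (by
      change (p : ℤ) • s = 0
      rw [natCast_zsmul]; exact hps))
  exact hs0 (congrArg Subtype.val h0)

end Summit.BirchSwinnertonDyer.BirchSwinnertonDyer.Theorems.PrintCFram.SelmerCount

end
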